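import Summits.QuantumFields.BalabanUV.Beta.FP.MixLoopPowerCountingMassQuartic
import Summits.QuantumFields.BalabanUV.Beta.FP.GhostLoopCountingFar

/-!
# `BalabanUV.Beta.FP.GhostLoopCountingFarContract` — road «FP» for binder row D1, organisation γ, row **(GH-a) COUNTING** (R-FP-28 (d)), pieces
# **(g2)** far window ∕ **(g3)** ultra-local: the J-CONTRACTION of `FP/GhostLoopCountingFar`'s (Mκ) letters BY NAME
# `FP/MixLoopPowerCountingMassQuartic.coarse_secondMoment_of_majorant` at `κ := |k|` — the two pieces' contributions in the coarse weighted-sum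
# currency `Σ_{v∈V}‖v−v₀‖∞²·|Σ_{b,b′∈S} J b v₀·J b′ v·k b b′| ≤ 3·C_J·C_J′·(1 + 16∕δ²)·A_κ` ([folklore] lattice bookkeeping on `ℤ⁴`; abstract kernels; NO road object)

HONEST DEPENDENCY (page 1, mandatory): continuum YM on T⁴ ⇐ BetaPertH ∧ nine spine estimates (0/9 proved); BetaPertH ⇐ (D1) ∧ (D4) ∧
CAP+tail; G-an2-4 gates asym, D1 and NE2/3/4.  HONEST FRAMING (cell contract, verbatim): «discharging `BetaPertH` makes Bałaban's UV
stability UNCONDITIONAL — a real constructive-QFT result; it is NOT the continuum limit and NOT the Clay problem.»  THIS MODULE composes two tree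
theorems BY NAME; it asserts nothing about Bałaban's objects, cites nothing, mints no `Prop` fact, has no `def`, 0 sorry.  The letters (J) `|J b v₀| ≤ C_J·e^{−(δ∕n)‖b−n•v₀‖∞}`,
(J′) `Σ_{v∈V}(1 + ‖b′−n•v‖∞²∕n²)·|J b′ v| ≤ C_J′` are `FP/MixLoopPowerCountingMass`'s VERBATIM; (far-0)∕(far) and (loc-0)∕(loc) are `FP/GhostLoopCountingFar`'s.
Instance values and the powers of `n` they carry are row RHOA-6e's bookkeeping.  NOT (GH-a) ((g1)(g4)(g5) are not here), NOT `hbook`, NOT D1, NOT BetaPertH,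
NOT continuum, NOT Clay.

ABSOLUTE RULE (cell charter, verbatim): «No internally-minted statement may enter as a cited fact. Every hypothesis is either kernel-proved in this
package or a verbatim quotation of a PUBLISHED theorem with page reference. The manuscript(s) under audit are NOT citable for their own disputed
steps — they are the thing under adjudication; programme-internal (2001/route/tribunal) claims are never citable.»
Provenance: unit `b2b-balaban-t4-ne7b-formalise-leaf-09` (gen 21, cross-cell duty NE7b → road FP), 2026-08-21; «not in print; our bookkeeping»; no existing file touched.
-/

noncomputable section

namespace Summit.QuantumFields.BalabanUV.Beta.FP.GhostLoopCountingFarContract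

open Finset Real
open scoped BigOperators
open Literature.MathematicalPhysics.QuantumFieldTheory.Balaban1983to89.Beta.DyadicShell (Pt supNorm)
open Summit.QuantumFields.BalabanUV.Beta.FP.MixLoopPowerCountingMassQuartic (coarse_secondMoment_of_majorant)
open Summit.QuantumFields.BalabanUV.Beta.FP.GhostLoopCountingFar (majorantLetter_far majorantLetter_local)

variable {k J : Pt → Pt → ℝ} {C C_loc C_J C_J' a δ : ℝ} {n : ℕ}

/-- [folklore] **(g2) THE FAR WINDOW, J-CONTRACTED**: under (J), (J′), (far-0), (far), for finite fine∕coarse windows `S`, `V` and reference row `v₀`,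
`Σ_{v∈V}‖v−v₀‖∞²·|Σ_{b,b′∈S} J b v₀·J b′ v·k b b′| ≤ 3·C_J·C_J′·(1 + 16∕δ²)·((1 + 480·e^{δ∕4}·(4∕δ)⁴)·(160·C·(1 + 1∕a))·n²)`
(`coarse_secondMoment_of_majorant` at `κ := |k|` with `GhostLoopCountingFar.majorantLetter_far`). -/
theorem coarse_secondMoment_far (hδ : 0 < δ) (hC : 0 ≤ C) (ha : 0 < a) (hn : 1 ≤ n) (S V : Finset Pt) (v₀ : Pt)
    (hJ : ∀ b, |J b v₀| ≤ C_J * Real.exp (-(δ / n) * (supNorm (b - (n : ℤ) • v₀) : ℝ)))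
    (hJ' : ∀ b', ∑ v ∈ V, (1 + ((supNorm (b' - (n : ℤ) • v) : ℝ) / n) ^ 2) * |J b' v| ≤ C_J')
    (hk0 : ∀ b b', supNorm (b' - b) ≤ n → k b b' = 0)
    (hkfar : ∀ b b', n < supNorm (b' - b) →
      |k b b'| ≤ C / (supNorm (b' - b) : ℝ) ^ 6 * Real.exp (-(a / n) * (supNorm (b' - b) : ℝ))) :
    ∑ v ∈ V, (supNorm (v - v₀) : ℝ) ^ 2 * |∑ b ∈ S, ∑ b' ∈ S, J b v₀ * J b' v * k b b'|
      ≤ 3 * C_J * C_J' * (1 + 16 / δ ^ 2) *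
          ((1 + 480 * Real.exp (δ / 4) * (4 / δ) ^ 4) * (160 * C * (1 + 1 / a)) * (n : ℝ) ^ 2) :=
  coarse_secondMoment_of_majorant hδ hn S V v₀ (fun _ _ => le_rfl) hJ hJ' (majorantLetter_far hδ hC ha hn S v₀ hk0 hkfar)

/-- [folklore] **(g3) AN ULTRA-LOCAL PIECE, J-CONTRACTED**: under (J), (J′), (loc-0), (loc),
`Σ_{v∈V}‖v−v₀‖∞²·|Σ_{b,b′∈S} J b v₀·J b′ v·k b b′| ≤ 3·C_J·C_J′·(1 + 16∕δ²)·((1 + 480·e^{δ∕4}·(4∕δ)⁴)·n⁴·((2r+1)⁴·(1 + (r∕n)²)·C_loc))`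
(`coarse_secondMoment_of_majorant` at `κ := |k|` with `GhostLoopCountingFar.majorantLetter_local`). -/
theorem coarse_secondMoment_local (hδ : 0 < δ) (hC : 0 ≤ C_loc) (hn : 1 ≤ n) (r : ℕ) (S V : Finset Pt) (v₀ : Pt)
    (hJ : ∀ b, |J b v₀| ≤ C_J * Real.exp (-(δ / n) * (supNorm (b - (n : ℤ) • v₀) : ℝ)))
    (hJ' : ∀ b', ∑ v ∈ V, (1 + ((supNorm (b' - (n : ℤ) • v) : ℝ) / n) ^ 2) * |J b' v| ≤ C_J')
    (hk0 : ∀ b b', r < supNorm (b' - b) → k b b' = 0)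
    (hkloc : ∀ b b', supNorm (b' - b) ≤ r → |k b b'| ≤ C_loc) :
    ∑ v ∈ V, (supNorm (v - v₀) : ℝ) ^ 2 * |∑ b ∈ S, ∑ b' ∈ S, J b v₀ * J b' v * k b b'|
      ≤ 3 * C_J * C_J' * (1 + 16 / δ ^ 2) *
          ((1 + 480 * Real.exp (δ / 4) * (4 / δ) ^ 4) * (n : ℝ) ^ 4 * ((2 * (r : ℝ) + 1) ^ 4 * ((1 + ((r : ℝ) / n) ^ 2) * C_loc))) :=
  coarse_secondMoment_of_majorant hδ hn S V v₀ (fun _ _ => le_rfl) hJ hJ' (majorantLetter_local hδ hC hn r S v₀ hk0 hkloc)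

end Summit.QuantumFields.BalabanUV.Beta.FP.GhostLoopCountingFarContract

end
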